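import Summits.CriticalPhenomena.PercolationContinuityZ3.Theorems.PercNearOneGluingAdditiveGluingSetObserverAssembly
import HarnessLib

/-!
# Conjecture G / SET-W via a SET observer, XXII: (S-Δ), SET-W and the glued gap of the stub, ROBUST in the minimality of the designated relay

Support file (`--supports stmt-CriticalPhenomena-4576`); no definitions, no named facts, no sorries.  Seat (b) V⁺-form `png-dp-vplus`, gen 13
(memo MEMO-gen13.md §3).  Copies of gen 12's `…SetObserverAssembly.lean` with the minimality hypothesis weakened to `τ(d) ≤ τ(a) + δ`
(`δ ≥ 0`) and every conclusion weakened by an explicit error (input: the robust Theorem 2-set `CSHSet.preMarginSet_ge_of_cshSet_approx`):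
* `SetSurplus.setPreSurplus_ge_of_twoObs_approx` — (S-Δ)(X) `≥ −δ·|X|·2^{|X|}` from the peel bound and the approximate two-observer margin;
* `SetSurplus.setW_of_twoObs_approx` — SET-W up to `δ·|A|·2^{|A|}`;
* `SetSurplus.fingerML3_gap_of_twoObs_approx` — the glued gap of the stub is `≥ −δ·|A|·2^{|A|}` (through the gap identity
  `finger_glued_gap_eq_unglued_gap`);
(the CSH-set versions `CSHSet.setTwoObs_of_cshSet_approx` / `fingerML3_gap_of_cshSet_approx` follow in `…SetObserverAssemblyApprox.lean`).
[cite: KozmaNitzan2024, Thm 4 (pp. 12–14), Conj. 4 (p. 32)] [cite: VandenbergHaggstromKahn2005, §2.1 (pp. 9–13), Thm. 2.1 (p. 9)]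
-/

noncomputable section

namespace Summit.CriticalPhenomena.PercolationContinuityZ3.Theorems

open MeasureTheory Set Literature.Probability.LatticeModels Literature.Probability.Percolation
open scoped Classical

namespace SetSurplus

open KNPreFKG

variable {n : ℕ}

/-- **(S-Δ) up to `δ·|X|·2^{|X|}` from the peel bound and the APPROXIMATE restricted two-observer surplus inequality** (robust copy of
`setPreSurplus_nonneg_of_twoObs'`). [cite: VandenbergHaggstromKahn2005, §1 p. 8, §2.1 Lemma 2.3 (p. 10)] [cite: KozmaNitzan2024, Conj. 4 (p. 32)] -/
theorem setPreSurplus_ge_of_twoObs_approx (w : Sym2 (Fin n) → unitInterval) (O : Finset (Fin n)) (F : Set (Fin n) → ℝ)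
    (hF : ∀ S T : Set (Fin n), S ⊆ T → F S ≤ F T) (c : Fin n) (r : Fin n → ℕ) (X₀ : Finset (Fin n)) (δ : ℝ) (hδ : 0 ≤ δ)
    (h2obs : ∀ (X' : Finset (Fin n)) (k : Fin n), X' ⊆ X₀ → k ∈ X₀ → c ∈ X' → k ∉ X' →
      (∀ a ∈ X', ∫ ω, F (openCluster ω c) ∂(prodBernoulli w) ≤ (∫ ω, F (openCluster ω a) ∂(prodBernoulli w)) + δ) →
      (∀ a ∈ X', a ≠ c → r c < r a) → Set.InjOn r ↑X' →
      (prodBernoulli w).real ({ω : BondConfig (Fin n) | ∃ o ∈ O, (openGraph ω).Reachable o k} ∩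
          {ω | ∀ o ∈ O, ∀ a ∈ X', ¬ (openGraph ω).Reachable o a}) *
        (∫ ω in ⋃ a ∈ X', openConn k a, (F (openCluster ω k) - F (openCluster ω c)) ∂(prodBernoulli w)) ≤
      (prodBernoulli w).real {ω : BondConfig (Fin n) | ∀ a ∈ (↑X' : Set (Fin n)), ¬ (openGraph ω).Reachable k a} *
        ∑ a ∈ X', ∫ ω in {ω : BondConfig (Fin n) | ∃ o ∈ O, (openGraph ω).Reachable o a} ∩
          {ω | ∀ a' ∈ X', r a' < r a → ∀ o ∈ O, ¬ (openGraph ω).Reachable o a'},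
          (F (openCluster ω a) - F (openCluster ω c)) ∂(prodBernoulli w) +
      (prodBernoulli w).real {ω : BondConfig (Fin n) | ∀ a ∈ (↑X' : Set (Fin n)), ¬ (openGraph ω).Reachable k a} *
        (δ * (X'.card : ℝ) * 2 ^ X'.card))
    (X : Finset (Fin n)) (hXX₀ : X ⊆ X₀) (hcX : c ∈ X)
    (hcmin : ∀ a ∈ X, ∫ ω, F (openCluster ω c) ∂(prodBernoulli w) ≤ (∫ ω, F (openCluster ω a) ∂(prodBernoulli w)) + δ)
    (hrc : ∀ a ∈ X, a ≠ c → r c < r a) (hr : Set.InjOn r ↑X) :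
    -(δ * (X.card : ℝ) * 2 ^ X.card) ≤ ∑ a ∈ X, ∫ ω in {ω : BondConfig (Fin n) | ∃ o ∈ O, (openGraph ω).Reachable o a} ∩
          {ω | ∀ a' ∈ X, r a' < r a → ∀ o ∈ O, ¬ (openGraph ω).Reachable o a'},
          (F (openCluster ω a) - F (openCluster ω c)) ∂(prodBernoulli w) := by
  set μ := prodBernoulli w with hμ
  have hmeas : ∀ S : Set (BondConfig (Fin n)), MeasurableSet S := fun _ => MeasurableSet.of_discrete
  have hint : ∀ (g : BondConfig (Fin n) → ℝ), Integrable g μ := fun g => Integrable.of_finite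
  -- strong induction on `|X|`
  suffices main : ∀ (N : ℕ) (X : Finset (Fin n)), X.card = N → X ⊆ X₀ → c ∈ X →
      (∀ a ∈ X, ∫ ω, F (openCluster ω c) ∂μ ≤ (∫ ω, F (openCluster ω a) ∂μ) + δ) →
      (∀ a ∈ X, a ≠ c → r c < r a) → Set.InjOn r ↑X →
      -(δ * (X.card : ℝ) * 2 ^ X.card) ≤ ∑ a ∈ X, ∫ ω in {ω : BondConfig (Fin n) | ∃ o ∈ O, (openGraph ω).Reachable o a} ∩
          {ω | ∀ a' ∈ X, r a' < r a → ∀ o ∈ O, ¬ (openGraph ω).Reachable o a'},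
          (F (openCluster ω a) - F (openCluster ω c)) ∂μ from main X.card X rfl hXX₀ hcX hcmin hrc hr
  intro N
  induction N using Nat.strong_induction_on with
  | _ N ih =>
  intro X hN hXX₀ hcX hcmin hrc hr
  rcases (X.erase c).eq_empty_or_nonempty with h0 | hne
  · -- `X = {c}`: the only term vanishes
    have hXc : X = {c} := by rw [← Finset.insert_erase hcX, h0]; rfl
    rw [hXc, Finset.sum_singleton]
    rw [setIntegral_congr_fun (hmeas _) (g := fun _ => (0 : ℝ)) (fun ω _ => by simp)]
    simp only [integral_zero, Finset.card_singleton, Nat.cast_one, mul_one, pow_one, Left.neg_nonpos_iff]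
    positivity
  -- peel the rank-maximal relay `k ≠ c`
  obtain ⟨k, hk, hkmax⟩ := Finset.exists_max_image (X.erase c) r hne
  have hkc : k ≠ c := (Finset.mem_erase.1 hk).1
  have hkX : k ∈ X := (Finset.mem_erase.1 hk).2
  have hmax : ∀ a ∈ X, a ≠ k → r a < r k := by
    intro a ha hak
    by_cases hac : a = c
    · rw [hac]; exact hrc k hkX hkc
    · have hle : r a ≤ r k := hkmax a (Finset.mem_erase.2 ⟨hac, ha⟩)
      exact lt_of_le_of_ne hle fun h => hak (hr (Finset.mem_coe.2 ha) (Finset.mem_coe.2 hkX) h)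
  set X' : Finset (Fin n) := X.erase k with hX'
  have hX'X : ∀ a ∈ X', a ∈ X := fun a ha => Finset.mem_of_mem_erase ha
  have hkX' : k ∉ X' := Finset.notMem_erase k X
  have hcX' : c ∈ X' := Finset.mem_erase.2 ⟨hkc.symm, hcX⟩
  have hcard : X'.card < N := by
    have hpos := Finset.card_pos.2 ⟨k, hkX⟩
    rw [hX', Finset.card_erase_of_mem hkX]; omega
  have hcmin' : ∀ a ∈ X', ∫ ω, F (openCluster ω c) ∂μ ≤ (∫ ω, F (openCluster ω a) ∂μ) + δ := fun a ha => hcmin a (hX'X a ha)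
  have hrc' : ∀ a ∈ X', a ≠ c → r c < r a := fun a ha hac => hrc a (hX'X a ha) hac
  have hr' : Set.InjOn r ↑X' := hr.mono (by intro a ha; exact Finset.mem_coe.2 (hX'X a (Finset.mem_coe.1 ha)))
  have hX'X₀ : X' ⊆ X₀ := fun a ha => hXX₀ (hX'X a ha)
  have hIH := ih X'.card hcard X' rfl hX'X₀ hcX' hcmin' hrc' hr'
  rw [setPreSurplus_erase_add w O X r F c k hkX hmax]
  set Dk : Set (BondConfig (Fin n)) := {ω : BondConfig (Fin n) | ∀ a ∈ (↑X' : Set (Fin n)), ¬ (openGraph ω).Reachable k a}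
    with hDk
  set Ev : Set (BondConfig (Fin n)) := {ω : BondConfig (Fin n) | ∃ o ∈ O, (openGraph ω).Reachable o k} ∩
    {ω | ∀ o ∈ O, ∀ a ∈ X', ¬ (openGraph ω).Reachable o a} with hEv
  set gk : BondConfig (Fin n) → ℝ := fun ω => F (openCluster ω k) - F (openCluster ω c) with hgk
  set ΔO : ℝ := ∑ a ∈ X', ∫ ω in {ω : BondConfig (Fin n) | ∃ o ∈ O, (openGraph ω).Reachable o a} ∩
      {ω | ∀ a' ∈ X', r a' < r a → ∀ o ∈ O, ¬ (openGraph ω).Reachable o a'}, (F (openCluster ω a) - F (openCluster ω c)) ∂μ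
    with hΔO
  set Δk : ℝ := ∫ ω in ⋃ a' ∈ X', openConn k a', gk ω ∂μ with hΔk
  set T : ℝ := ∫ ω in Ev, gk ω ∂μ with hT
  set J : ℝ := ∫ ω in Dk, gk ω ∂μ with hJ
  set M : ℝ := μ.real Dk with hM
  set E : ℝ := μ.real Ev with hE
  have hEvD : Ev ⊆ Dk := by
    rintro ω ⟨⟨o, ho, hok⟩, h2⟩ a ha hka
    exact h2 o ho a (Finset.mem_coe.1 ha) (hok.trans hka)
  have hE0 : 0 ≤ E := measureReal_nonneg
  have hM0 : 0 ≤ M := measureReal_nonneg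
  -- `J = (m_k − m_c) − Δ_k(X')`
  have hJtot : J = ((∫ ω, F (openCluster ω k) ∂μ) - ∫ ω, F (openCluster ω c) ∂μ) - Δk := by
    have h1 := integral_add_compl (hmeas Dk) (hint gk)
    have hDkc : Dkᶜ = ⋃ a' ∈ X', (openConn k a' : Set (BondConfig (Fin n))) := by
      ext ω
      rw [PreFKGSurplus.mem_iUnion_openConn, mem_compl_iff, hDk]
      simp only [mem_setOf_eq, Finset.mem_coe, not_forall, not_not, exists_prop]
    have h2 : ∫ ω in Dkᶜ, gk ω ∂μ = Δk := by rw [hDkc]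
    have h3 : ∫ ω, gk ω ∂μ = (∫ ω, F (openCluster ω k) ∂μ) - ∫ ω, F (openCluster ω c) ∂μ := by
      rw [hgk, integral_sub (hint _) (hint _)]
    rw [hJ]; linarith
  have hmk : -δ ≤ (∫ ω, F (openCluster ω k) ∂μ) - ∫ ω, F (openCluster ω c) ∂μ := by linarith [hcmin k hkX]
  have hEM : E ≤ M := measureReal_mono hEvD (measure_ne_top μ _)
  -- error bookkeeping: `1 + (N-1)·2^(N-1) ≤ N·2^N` and `(N-1)·2^(N-1) ≤ N·2^N`
  have hcardX' : (X'.card : ℝ) = X.card - 1 := by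
    rw [hX', Finset.card_erase_of_mem hkX, Nat.cast_sub (Finset.card_pos.2 ⟨k, hkX⟩)]; simp
  have hNpos : 1 ≤ X.card := Finset.card_pos.2 ⟨k, hkX⟩
  have hN1 : (1 : ℝ) ≤ X.card := by exact_mod_cast hNpos
  have hpowle : (2 : ℝ) ^ X'.card ≤ 2 ^ X.card := pow_le_pow_right₀ (by norm_num) (by rw [hX', Finset.card_erase_of_mem hkX]; omega)
  have hpow1 : (1 : ℝ) ≤ 2 ^ X.card := one_le_pow₀ (by norm_num)
  have hpos2 : (0 : ℝ) ≤ 2 ^ X'.card := by positivity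
  have herr1 : δ * (X'.card : ℝ) * 2 ^ X'.card ≤ δ * (X.card : ℝ) * 2 ^ X.card := by
    rw [hcardX']
    have : (X.card - 1 : ℝ) * 2 ^ X'.card ≤ (X.card : ℝ) * 2 ^ X.card := by nlinarith
    nlinarith
  have herr2 : δ * (1 + (X'.card : ℝ) * 2 ^ X'.card) ≤ δ * (X.card : ℝ) * 2 ^ X.card := by
    rw [hcardX']
    have : 1 + (X.card - 1 : ℝ) * 2 ^ X'.card ≤ (X.card : ℝ) * 2 ^ X.card := by nlinarith
    nlinarith
  -- the two-set bound `E·J ≤ M·T` and the APPROXIMATE set two-observer margin `E·Δk ≤ M·ΔO + M·δ'`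
  have hpeel : E * J ≤ M * T := setObserver_peel_bound w X' O F hF c k hcX'
  have h2 : E * Δk ≤ M * ΔO + M * (δ * (X'.card : ℝ) * 2 ^ X'.card) := h2obs X' k hX'X₀ (hXX₀ hkX) hcX' hkX' hcmin' hrc' hr'
  rcases hM0.eq_or_lt with hM00 | hMpos
  · -- degenerate case `μ(k ↮ X') = 0`: the peeled term vanishes, use the induction hypothesis
    have hD0 : μ Dk = 0 := (measureReal_eq_zero_iff (measure_ne_top μ Dk)).1 hM00.symm
    have hEv0 : μ Ev = 0 := measure_mono_null hEvD hD0
    have hT0 : T = 0 := setIntegral_measure_zero _ hEv0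
    rw [hT0, add_zero]
    linarith [hIH, herr1]
  · have hfin : -(M * (δ * (1 + (X'.card : ℝ) * 2 ^ X'.card))) ≤ M * (ΔO + T) := by
      have : E * ((∫ ω, F (openCluster ω k) ∂μ) - ∫ ω, F (openCluster ω c) ∂μ) ≤
          M * (ΔO + T) + M * (δ * (X'.card : ℝ) * 2 ^ X'.card) := by
        nlinarith [hpeel, h2, hJtot]
      have h3 : -(E * δ) ≤ E * ((∫ ω, F (openCluster ω k) ∂μ) - ∫ ω, F (openCluster ω c) ∂μ) := by nlinarith [hE0, hmk]
      nlinarith [this, h3, hEM, hδ]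
    have hdiv : -(δ * (1 + (X'.card : ℝ) * 2 ^ X'.card)) ≤ ΔO + T :=
      le_of_mul_le_mul_left (by linarith [hfin]) hMpos
    linarith [hdiv, herr2]

/-- **SET-W up to `δ·|A|·2^{|A|}` from the approximate restricted two-observer surplus inequality** (robust copy of `setW_of_twoObs'`).
[cite: KozmaNitzan2024, Conj. 4 (p. 32)] [cite: VandenbergHaggstromKahn2005, §2.1 (pp. 9–13)] -/
theorem setW_of_twoObs_approx (w : Sym2 (Fin n) → unitInterval) (A O : Finset (Fin n)) (d b : Fin n) (hdA : d ∈ A) (δ : ℝ) (hδ : 0 ≤ δ)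
    (hmin : ∀ a ∈ A, (prodBernoulli w).real (openConn d b) ≤ (prodBernoulli w).real (openConn a b) + δ)
    (h2obs : ∀ (r : Fin n → ℕ) (X' : Finset (Fin n)) (k : Fin n), X' ⊆ A → k ∈ A → d ∈ X' → k ∉ X' →
      (∀ a ∈ X', ∫ ω, (fun S : Set (Fin n) => if b ∈ S then (1 : ℝ) else 0) (openCluster ω d) ∂(prodBernoulli w) ≤
        (∫ ω, (fun S : Set (Fin n) => if b ∈ S then (1 : ℝ) else 0) (openCluster ω a) ∂(prodBernoulli w)) + δ) →
      (∀ a ∈ X', a ≠ d → r d < r a) → Set.InjOn r ↑X' →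
      (prodBernoulli w).real ({ω : BondConfig (Fin n) | ∃ o ∈ O, (openGraph ω).Reachable o k} ∩
          {ω | ∀ o ∈ O, ∀ a ∈ X', ¬ (openGraph ω).Reachable o a}) *
        (∫ ω in ⋃ a ∈ X', openConn k a, ((fun S : Set (Fin n) => if b ∈ S then (1 : ℝ) else 0) (openCluster ω k) -
          (fun S : Set (Fin n) => if b ∈ S then (1 : ℝ) else 0) (openCluster ω d)) ∂(prodBernoulli w)) ≤
      (prodBernoulli w).real {ω : BondConfig (Fin n) | ∀ a ∈ (↑X' : Set (Fin n)), ¬ (openGraph ω).Reachable k a} *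
        ∑ a ∈ X', ∫ ω in {ω : BondConfig (Fin n) | ∃ o ∈ O, (openGraph ω).Reachable o a} ∩
          {ω | ∀ a' ∈ X', r a' < r a → ∀ o ∈ O, ¬ (openGraph ω).Reachable o a'},
          ((fun S : Set (Fin n) => if b ∈ S then (1 : ℝ) else 0) (openCluster ω a) -
            (fun S : Set (Fin n) => if b ∈ S then (1 : ℝ) else 0) (openCluster ω d)) ∂(prodBernoulli w) +
      (prodBernoulli w).real {ω : BondConfig (Fin n) | ∀ a ∈ (↑X' : Set (Fin n)), ¬ (openGraph ω).Reachable k a} *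
        (δ * (X'.card : ℝ) * 2 ^ X'.card)) :
    (prodBernoulli w).real (openConn d b ∩ {ω : BondConfig (Fin n) | ∀ o ∈ O, ¬ (openGraph ω).Reachable o d} ∩
        {ω | ∃ o ∈ O, ∃ a ∈ A, (openGraph ω).Reachable o a}) ≤
      (prodBernoulli w).real ({ω : BondConfig (Fin n) | ∃ o ∈ O, (openGraph ω).Reachable o b} ∩
        {ω | ∀ o ∈ O, ¬ (openGraph ω).Reachable o d}) + δ * (A.card : ℝ) * 2 ^ A.card := by
  set μ := prodBernoulli w with hμ
  have hmeas : ∀ S : Set (BondConfig (Fin n)), MeasurableSet S := fun _ => MeasurableSet.of_discrete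
  have hint : ∀ (g : BondConfig (Fin n) → ℝ), Integrable g μ := fun g => Integrable.of_finite
  set F : Set (Fin n) → ℝ := fun S => if b ∈ S then (1 : ℝ) else 0 with hFdef
  have hF : ∀ S T : Set (Fin n), S ⊆ T → F S ≤ F T := by
    intro S T hST; simp only [hFdef]
    by_cases hS : b ∈ S
    · rw [if_pos hS, if_pos (hST hS)]
    · rw [if_neg hS]; split_ifs <;> norm_num
  -- rank: `d` first, then the vertex index
  set r : Fin n → ℕ := fun a => if a = d then 0 else (a : ℕ) + 1 with hr
  have hrd : ∀ a ∈ A, a ≠ d → r d < r a := by intro a _ had; simp [hr, had]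
  have hrinj : Set.InjOn r ↑A := by
    intro a _ a' _ h
    simp only [hr] at h
    by_cases ha : a = d <;> by_cases ha' : a' = d
    · rw [ha, ha']
    · rw [if_pos ha, if_neg ha'] at h; omega
    · rw [if_neg ha, if_pos ha'] at h; omega
    · rw [if_neg ha, if_neg ha'] at h; exact Fin.ext (by omega)
  have hcmin : ∀ a ∈ A, ∫ ω, F (openCluster ω d) ∂μ ≤ (∫ ω, F (openCluster ω a) ∂μ) + δ := by
    intro a ha
    rw [integral_indicator_mem_openCluster, integral_indicator_mem_openCluster]
    exact hmin a ha
  have hpos := setPreSurplus_ge_of_twoObs_approx w O F hF d r A δ hδ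
    (fun X' k hX hkA hd hk hm hrk hinj => h2obs r X' k hX hkA hd hk hm hrk hinj) A subset_rfl hdA hcmin hrd hrinj
  -- the pattern events and their values for `F = 1{b ∈ ·}`
  set P : Fin n → Set (BondConfig (Fin n)) := fun a => {ω : BondConfig (Fin n) | ∃ o ∈ O, (openGraph ω).Reachable o a} ∩
    {ω | ∀ a' ∈ A, r a' < r a → ∀ o ∈ O, ¬ (openGraph ω).Reachable o a'} with hP
  have hterm : ∀ a ∈ A, ∫ ω in P a, (F (openCluster ω a) - F (openCluster ω d)) ∂μ =
      μ.real (P a ∩ openConn a b) - μ.real (P a ∩ openConn d b) := by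
    intro a _
    rw [integral_sub (hint _).integrableOn (hint _).integrableOn]
    have e1 : ∀ u : Fin n, ∫ ω in P a, F (openCluster ω u) ∂μ = μ.real (P a ∩ openConn u b) := by
      intro u
      have : (fun ω : BondConfig (Fin n) => F (openCluster ω u)) = (openConn u b : Set (BondConfig (Fin n))).indicator 1 := by
        funext ω
        by_cases hω : ω ∈ (openConn u b : Set (BondConfig (Fin n)))
        · rw [indicator_of_mem hω, Pi.one_apply]; exact if_pos (show b ∈ openCluster ω u from hω)
        · rw [indicator_of_notMem hω]; exact if_neg (show b ∉ openCluster ω u from hω)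
      rw [this, setIntegral_indicator_one_eq]
    rw [e1 a, e1 d]
  have hsum : ∑ a ∈ A, ∫ ω in P a, (F (openCluster ω a) - F (openCluster ω d)) ∂μ =
      ∑ a ∈ A.erase d, (μ.real (P a ∩ openConn a b) - μ.real (P a ∩ openConn d b)) := by
    rw [← Finset.add_sum_erase A _ hdA, hterm d hdA, sub_self, zero_add]
    exact Finset.sum_congr rfl fun a ha => hterm a (Finset.mem_of_mem_erase ha)
  have hpos' : ∑ a ∈ A.erase d, μ.real (P a ∩ openConn d b) ≤ ∑ a ∈ A.erase d, μ.real (P a ∩ openConn a b) +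
      δ * (A.card : ℝ) * 2 ^ A.card := by
    have := hpos; rw [hsum, Finset.sum_sub_distrib] at this; linarith
  -- lower bound: the left-hand side of SET-W is covered by the patterns `P a`, `a ≠ d`
  have hcover : (openConn d b ∩ {ω : BondConfig (Fin n) | ∀ o ∈ O, ¬ (openGraph ω).Reachable o d} ∩
      {ω | ∃ o ∈ O, ∃ a ∈ A, (openGraph ω).Reachable o a}) ⊆ ⋃ a ∈ A.erase d, (P a ∩ openConn d b) := by
    rintro ω ⟨⟨hdb, hOd⟩, hOA⟩
    -- the touched relay of least rank
    obtain ⟨a₀, ha₀, ha₀min⟩ := Finset.exists_min_image (A.filter fun a => ∃ o ∈ O, (openGraph ω).Reachable o a) r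
      (by obtain ⟨o, ho, a, ha, hoa⟩ := hOA; exact ⟨a, Finset.mem_filter.2 ⟨ha, o, ho, hoa⟩⟩)
    obtain ⟨ha₀A, hta₀⟩ := Finset.mem_filter.1 ha₀
    have ha₀d : a₀ ≠ d := by rintro rfl; obtain ⟨o, ho, hod⟩ := hta₀; exact hOd o ho hod
    refine mem_iUnion₂.2 ⟨a₀, Finset.mem_erase.2 ⟨ha₀d, ha₀A⟩, ⟨hta₀, fun a' ha' hlt o ho hoa' => ?_⟩, hdb⟩
    have := ha₀min a' (Finset.mem_filter.2 ⟨ha', o, ho, hoa'⟩)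
    omega
  have hlow : μ.real (openConn d b ∩ {ω : BondConfig (Fin n) | ∀ o ∈ O, ¬ (openGraph ω).Reachable o d} ∩
      {ω | ∃ o ∈ O, ∃ a ∈ A, (openGraph ω).Reachable o a}) ≤ ∑ a ∈ A.erase d, μ.real (P a ∩ openConn d b) :=
    (measureReal_mono hcover (measure_ne_top μ _)).trans (measureReal_biUnion_finset_le _ _)
  -- upper bound: the events `P a ∩ {a ↔ b}`, `a ≠ d`, are disjoint subsets of `{O ~ b} ∩ {O ≁ d}`
  have hdisj : (↑(A.erase d) : Set (Fin n)).PairwiseDisjoint fun a => P a ∩ openConn a b := by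
    intro a ha a' ha' hne
    rw [Function.onFun, Set.disjoint_left]
    rintro ω ⟨⟨hta, hexa⟩, _⟩ ⟨⟨hta', hexa'⟩, _⟩
    have haA : a ∈ A := Finset.mem_of_mem_erase (Finset.mem_coe.1 ha)
    have ha'A : a' ∈ A := Finset.mem_of_mem_erase (Finset.mem_coe.1 ha')
    have hrne : r a ≠ r a' := fun h => hne (hrinj (Finset.mem_coe.2 haA) (Finset.mem_coe.2 ha'A) h)
    rcases lt_or_gt_of_ne hrne with hlt | hlt
    · obtain ⟨o, ho, hoa⟩ := hta; exact hexa' a haA hlt o ho hoa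
    · obtain ⟨o, ho, hoa'⟩ := hta'; exact hexa a' ha'A hlt o ho hoa'
  have hsub : (⋃ a ∈ A.erase d, (P a ∩ openConn a b)) ⊆ ({ω : BondConfig (Fin n) | ∃ o ∈ O, (openGraph ω).Reachable o b} ∩
        {ω | ∀ o ∈ O, ¬ (openGraph ω).Reachable o d}) := by
    intro ω hω
    obtain ⟨a, ha, ⟨hta, hexa⟩, hab⟩ := mem_iUnion₂.1 hω
    have had : a ≠ d := (Finset.mem_erase.1 ha).1
    have haA : a ∈ A := (Finset.mem_erase.1 ha).2
    obtain ⟨o, ho, hoa⟩ := hta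
    exact ⟨⟨o, ho, hoa.trans hab⟩, fun o' ho' ho'd => hexa d hdA (hrd a haA had) o' ho' ho'd⟩
  have hup : ∑ a ∈ A.erase d, μ.real (P a ∩ openConn a b) ≤ μ.real ({ω : BondConfig (Fin n) | ∃ o ∈ O, (openGraph ω).Reachable o b} ∩
        {ω | ∀ o ∈ O, ¬ (openGraph ω).Reachable o d}) := by
    rw [← measureReal_biUnion_finset hdisj (fun a _ => hmeas _)]
    exact measureReal_mono hsub (measure_ne_top μ _)
  linarith [hlow, hpos', hup]

/-- **The glued gap of `stub_fingerML3_vp` is `≥ −δ·|A|·2^{|A|}`** when `d` is a `δ`-approximate argmin (robust copy of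
`fingerML3_of_twoObs'`, through the gap identity `finger_glued_gap_eq_unglued_gap`). [cite: KozmaNitzan2024, Thm 4 (pp. 12–14)] -/
theorem fingerML3_gap_of_twoObs_approx (K : Sym2 (Fin n) → unitInterval) (A N : Finset (Fin n)) (d b : Fin n) (hbA : b ∈ A)
    (hNA : Disjoint N A) (hdA : d ∈ A) (hfree : ∀ v ∈ N, ∀ y : Fin n, y ∉ A → y ∉ N → (K s(v, y) : ℝ) = 0) (δ : ℝ) (hδ : 0 ≤ δ)
    (hmin : ∀ a ∈ A, (prodBernoulli K).real (openConn d b) ≤ (prodBernoulli K).real (openConn a b) + δ)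
    (h2obs : ∀ (r : Fin n → ℕ) (X' : Finset (Fin n)) (k : Fin n), X' ⊆ A → k ∈ A → d ∈ X' → k ∉ X' →
      (∀ a ∈ X', ∫ ω, (fun S : Set (Fin n) => if b ∈ S then (1 : ℝ) else 0) (openCluster ω d) ∂(prodBernoulli K) ≤
        (∫ ω, (fun S : Set (Fin n) => if b ∈ S then (1 : ℝ) else 0) (openCluster ω a) ∂(prodBernoulli K)) + δ) →
      (∀ a ∈ X', a ≠ d → r d < r a) → Set.InjOn r ↑X' →
      (prodBernoulli K).real ({ω : BondConfig (Fin n) | ∃ o ∈ N, (openGraph ω).Reachable o k} ∩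
          {ω | ∀ o ∈ N, ∀ a ∈ X', ¬ (openGraph ω).Reachable o a}) *
        (∫ ω in ⋃ a ∈ X', openConn k a, ((fun S : Set (Fin n) => if b ∈ S then (1 : ℝ) else 0) (openCluster ω k) -
          (fun S : Set (Fin n) => if b ∈ S then (1 : ℝ) else 0) (openCluster ω d)) ∂(prodBernoulli K)) ≤
      (prodBernoulli K).real {ω : BondConfig (Fin n) | ∀ a ∈ (↑X' : Set (Fin n)), ¬ (openGraph ω).Reachable k a} *
        ∑ a ∈ X', ∫ ω in {ω : BondConfig (Fin n) | ∃ o ∈ N, (openGraph ω).Reachable o a} ∩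
          {ω | ∀ a' ∈ X', r a' < r a → ∀ o ∈ N, ¬ (openGraph ω).Reachable o a'},
          ((fun S : Set (Fin n) => if b ∈ S then (1 : ℝ) else 0) (openCluster ω a) -
            (fun S : Set (Fin n) => if b ∈ S then (1 : ℝ) else 0) (openCluster ω d)) ∂(prodBernoulli K) +
      (prodBernoulli K).real {ω : BondConfig (Fin n) | ∀ a ∈ (↑X' : Set (Fin n)), ¬ (openGraph ω).Reachable k a} *
        (δ * (X'.card : ℝ) * 2 ^ X'.card)) :
    -(δ * (A.card : ℝ) * 2 ^ A.card) ≤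
      (prodBernoulli (fun e' : Sym2 (Fin n) => if (∀ y ∈ e', y ∈ N) ∧ ¬ e'.IsDiag then 1 else K e')).real
          ({ω : Set (Sym2 (Fin n)) | ∃ v ∈ N, ∃ a ∈ A, s(v, a) ∈ ω} ∩ ⋃ v ∈ N, openConn v b) -
        (prodBernoulli (fun e' : Sym2 (Fin n) => if (∀ y ∈ e', y ∈ N) ∧ ¬ e'.IsDiag then 1 else K e')).real
          ({ω : Set (Sym2 (Fin n)) | ∃ v ∈ N, ∃ a ∈ A, s(v, a) ∈ ω} ∩ openConn d b) := by
  set μ := prodBernoulli K with hμ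
  rw [finger_glued_gap_eq_unglued_gap K A N d b hNA]
  have hW := setW_of_twoObs_approx K A N d b hdA δ hδ hmin h2obs
  set R : Set (BondConfig (Fin n)) := {ω : Set (Sym2 (Fin n)) | ∃ v ∈ N, ∃ a ∈ A, s(v, a) ∈ ω} with hR
  set M : Set (BondConfig (Fin n)) := {ω : BondConfig (Fin n) | ∀ x ∈ (↑N : Set (Fin n)), ¬ (openGraph ω).Reachable d x} with hM
  -- the left-hand side of the set form sits inside the left-hand side of SET-W
  have h1 : (R ∩ M ∩ openConn d b) ⊆ (openConn d b ∩ {ω : BondConfig (Fin n) | ∀ o ∈ N, ¬ (openGraph ω).Reachable o d} ∩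
      {ω | ∃ o ∈ N, ∃ a ∈ A, (openGraph ω).Reachable o a}) := by
    rintro ω ⟨⟨⟨v, hv, a, ha, hva⟩, hMω⟩, hdb⟩
    have hvne : v ≠ a := fun h => Finset.disjoint_left.1 hNA hv (h ▸ ha)
    exact ⟨⟨hdb, fun o ho hod => hMω o (Finset.mem_coe.2 ho) hod.symm⟩,
      ⟨v, hv, a, ha, SimpleGraph.Adj.reachable ((openGraph_adj ω v a).2 ⟨hva, hvne⟩)⟩⟩
  -- the right-hand side of SET-W sits inside the right-hand side of the set form, up to the null event "N ↔ b off R"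
  have h2 : ({ω : BondConfig (Fin n) | ∃ o ∈ N, (openGraph ω).Reachable o b} ∩
      {ω | ∀ o ∈ N, ¬ (openGraph ω).Reachable o d}) ⊆
      (R ∩ M ∩ ⋃ v ∈ N, openConn v b) ∪ (Rᶜ ∩ ⋃ v ∈ N, ⋃ a ∈ A, openConn v a) := by
    rintro ω ⟨⟨o, ho, hob⟩, hNd⟩
    by_cases hRω : ω ∈ R
    · left
      refine ⟨⟨hRω, fun x hx hdx => hNd x (Finset.mem_coe.1 hx) hdx.symm⟩, mem_iUnion₂.2 ⟨o, ho, hob⟩⟩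
    · right
      exact ⟨hRω, mem_iUnion₂.2 ⟨o, ho, mem_iUnion₂.2 ⟨b, hbA, hob⟩⟩⟩
  have hnull : μ.real (Rᶜ ∩ ⋃ v ∈ N, ⋃ a ∈ A, openConn v a) = 0 := finger_noContact_reach_null K A N hNA hfree
  have hlo : μ.real (R ∩ M ∩ openConn d b) ≤ μ.real (openConn d b ∩ {ω : BondConfig (Fin n) | ∀ o ∈ N, ¬ (openGraph ω).Reachable o d} ∩
          {ω | ∃ o ∈ N, ∃ a ∈ A, (openGraph ω).Reachable o a}) := measureReal_mono h1 (measure_ne_top μ _)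
  have hhi : μ.real ({ω : BondConfig (Fin n) | ∃ o ∈ N, (openGraph ω).Reachable o b} ∩
          {ω | ∀ o ∈ N, ¬ (openGraph ω).Reachable o d}) ≤ μ.real (R ∩ M ∩ ⋃ v ∈ N, openConn v b) :=
    calc μ.real ({ω : BondConfig (Fin n) | ∃ o ∈ N, (openGraph ω).Reachable o b} ∩
          {ω | ∀ o ∈ N, ¬ (openGraph ω).Reachable o d})
        ≤ μ.real ((R ∩ M ∩ ⋃ v ∈ N, openConn v b) ∪ (Rᶜ ∩ ⋃ v ∈ N, ⋃ a ∈ A, openConn v a)) :=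
          measureReal_mono h2 (measure_ne_top μ _)
      _ ≤ μ.real (R ∩ M ∩ ⋃ v ∈ N, openConn v b) + μ.real (Rᶜ ∩ ⋃ v ∈ N, ⋃ a ∈ A, openConn v a) :=
          measureReal_union_le _ _
      _ = μ.real (R ∩ M ∩ ⋃ v ∈ N, openConn v b) := by rw [hnull, add_zero]
  show -(δ * (A.card : ℝ) * 2 ^ A.card) ≤ μ.real (R ∩ M ∩ ⋃ v ∈ N, openConn v b) - μ.real (R ∩ M ∩ openConn d b)
  linarith [hlo, hW, hhi]

end SetSurplus

end Summit.CriticalPhenomena.PercolationContinuityZ3.Theorems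

end
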